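/-
Copyright: cell pub-balaban-gaps (YM BLITZ Y1, track G1), seat g1-p2 GEN 10 (unit `pub-balaban-gaps-g1-p2`).  Row (D4) NODE O,
OBJECT ∕ MECHANISM level, generic: the conjugated SCHUR budgets that the per-cube coercivity lemmas consume
(`D4WalkBlockLocalInverseGaugeSchur.gaugedCoercive_of_schur`, `D4WalkModelGaugedSchur.gaugedCoercive_of_schur'`) REDUCED to plain row ∕
column sums: for a finite-RANGE kernel (`R(e,e′) ≠ 0 ⟹ ds(e,e′) ≤ r₁`) and a pseudo-distance `ds` with the triangle inequality, the
conjugating weights `e^{κ(ds(e,j) − ds(e′,j))}` cost at most `e^{κr₁}`, so `cRow ≤ e^{κr₁}·(row sum)`, `cCol ≤ e^{κr₁}·(column sum)` — also for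
the compression to an enlarged cube `□̃`, where only the sums RESTRICTED to `□̃` enter.  What then remains of the per-cube small-field input
is exactly a two-sided (3.37)-type window ON `□̃`.  HONEST FRAMING: elementary; nothing of Bałaban's asserted; (D4) instance 0∕1; NOT
BetaPertH, NOT continuum, NOT Clay.
-/
import Summits.QuantumFields.BalabanUV.Gaps.D4WalkBlockLocalInverse

/-!
# `Gaps.D4WalkBlockSchurRange` — conjugated Schur sums of a finite-range kernel from plain row ∕ column sums, also compressed
# (cell pub-balaban-gaps, seat g1-p2 gen 10)

HONEST DEPENDENCY (cell pub-balaban, verbatim): continuum YM on T⁴ ⇐ BetaPertH ∧ nine spine estimates (0/9 proved);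
BetaPertH ⇐ (D1) ∧ (D4) ∧ CAP+tail.

* `exp_conj_weight_le` (`e^{κ(ds(e,j) − ds(e′,j))} ≤ e^{κ ds(e,e′)}` by the triangle inequality), **`cRow_le_of_range`**, **`cCol_le_of_range`**
  (`≤ e^{κr₁}·` row ∕ column sum), **`cRow_compress_le_of_range`**, **`cCol_compress_le_of_range`** (the same for `compress R S` from the
  sums RESTRICTED to `S`).
Consumers: the `hSr` ∕ `hSc` hypotheses of `blockWalkExpansion_gaugedSchur` ∕ `acrossSmall_gaugedSchur`.  Words of row (D4) UNCHANGED.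

References: T. Bałaban, Comm. Math. Phys. **99** (1985) 389–434 [B9], (3.37) p. 396, (3.52)–(3.54) pp. 400–401, Cor. 3.6 p. 408.
-/

noncomputable section

namespace Summit.QuantumFields.BalabanUV.Gaps.D4WalkBlockSchurRange

open Finset
open scoped Matrix
open Summit.QuantumFields.BalabanUV.Beta.UnitLatticeLocalInverse (compress)
open Summit.QuantumFields.BalabanUV.Gaps.D4WalkBlockLocalInverse (cRow cCol)

variable {ι : Type*} [Fintype ι]

omit [Fintype ι] in
/-- the conjugating weight along a column weight `ds(·, j)` is at most `e^{κ ds(e,e′)}` (triangle inequality, `κ ≥ 0`). -/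
theorem exp_conj_weight_le (ds : ι → ι → ℝ) (htri : ∀ a b c, ds a c ≤ ds a b + ds b c) {κ : ℝ} (hκ : 0 ≤ κ) (j e e' : ι) :
    Real.exp (κ * (ds e j - ds e' j)) ≤ Real.exp (κ * ds e e') :=
  Real.exp_le_exp.2 (mul_le_mul_of_nonneg_left (by linarith [htri e e' j]) hκ)

/-- **CONJUGATED ROW SUM OF A FINITE-RANGE KERNEL**: `cRow R κ ds(·,j) e ≤ e^{κr₁}·Σ_{e′}‖R(e,e′)‖`. -/
theorem cRow_le_of_range (R : Matrix ι ι ℂ) (ds : ι → ι → ℝ) (htri : ∀ a b c, ds a c ≤ ds a b + ds b c) {κ r₁ w : ℝ}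
    (hκ : 0 ≤ κ) (hrange : ∀ e e', R e e' ≠ 0 → ds e e' ≤ r₁) (j e : ι) (hw : ∑ e', ‖R e e'‖ ≤ w) :
    cRow R κ (fun e => ds e j) e ≤ Real.exp (κ * r₁) * w := by
  unfold cRow
  calc ∑ e', ‖R e e'‖ * Real.exp (κ * (ds e j - ds e' j)) ≤ ∑ e', ‖R e e'‖ * Real.exp (κ * r₁) := by
        refine Finset.sum_le_sum fun e' _ => ?_
        by_cases h : R e e' = 0
        · rw [h, norm_zero, zero_mul, zero_mul]
        · exact mul_le_mul_of_nonneg_left ((exp_conj_weight_le ds htri hκ j e e').trans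
            (Real.exp_le_exp.2 (mul_le_mul_of_nonneg_left (hrange e e' h) hκ))) (norm_nonneg _)
    _ = Real.exp (κ * r₁) * ∑ e', ‖R e e'‖ := by rw [Finset.mul_sum]; exact Finset.sum_congr rfl fun e' _ => by ring
    _ ≤ Real.exp (κ * r₁) * w := mul_le_mul_of_nonneg_left hw (Real.exp_pos _).le

/-- **CONJUGATED COLUMN SUM OF A FINITE-RANGE KERNEL**: `cCol R κ ds(·,j) e′ ≤ e^{κr₁}·Σ_{e}‖R(e,e′)‖`. -/
theorem cCol_le_of_range (R : Matrix ι ι ℂ) (ds : ι → ι → ℝ) (htri : ∀ a b c, ds a c ≤ ds a b + ds b c) {κ r₁ w : ℝ}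
    (hκ : 0 ≤ κ) (hrange : ∀ e e', R e e' ≠ 0 → ds e e' ≤ r₁) (j e' : ι) (hw : ∑ e, ‖R e e'‖ ≤ w) :
    cCol R κ (fun e => ds e j) e' ≤ Real.exp (κ * r₁) * w := by
  unfold cCol
  calc ∑ e, ‖R e e'‖ * Real.exp (κ * (ds e j - ds e' j)) ≤ ∑ e, ‖R e e'‖ * Real.exp (κ * r₁) := by
        refine Finset.sum_le_sum fun e _ => ?_
        by_cases h : R e e' = 0
        · rw [h, norm_zero, zero_mul, zero_mul]
        · exact mul_le_mul_of_nonneg_left ((exp_conj_weight_le ds htri hκ j e e').trans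
            (Real.exp_le_exp.2 (mul_le_mul_of_nonneg_left (hrange e e' h) hκ))) (norm_nonneg _)
    _ = Real.exp (κ * r₁) * ∑ e, ‖R e e'‖ := by rw [Finset.mul_sum]; exact Finset.sum_congr rfl fun e _ => by ring
    _ ≤ Real.exp (κ * r₁) * w := mul_le_mul_of_nonneg_left hw (Real.exp_pos _).le

omit [Fintype ι] in
/-- **THE SAME FOR THE COMPRESSION TO AN ENLARGED CUBE** (only the row sums RESTRICTED to `S` enter):
`cRow (compress R S) κ ds(·,j) e ≤ e^{κr₁}·Σ_{e′ ∈ S}‖R(e,e′)‖`. [cite: Balaban1985BackgroundPropagators, (3.37) p.396, Cor. 3.6 p.408] -/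
theorem cRow_compress_le_of_range (R : Matrix ι ι ℂ) (S : Finset ι) (ds : ι → ι → ℝ) (htri : ∀ a b c, ds a c ≤ ds a b + ds b c)
    {κ r₁ w : ℝ} (hκ : 0 ≤ κ) (hrange : ∀ e e', R e e' ≠ 0 → ds e e' ≤ r₁) (j e : S)
    (hw : ∑ e' : S, ‖R e e'‖ ≤ w) :
    cRow (compress R S) κ (fun e : S => ds e j) e ≤ Real.exp (κ * r₁) * w :=
  cRow_le_of_range (compress R S) (fun a b : S => ds a b) (fun a b c => htri a b c) hκ
    (fun a b h => hrange a b (by simpa [compress] using h)) j e (by simpa [compress] using hw)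

omit [Fintype ι] in
/-- and for the compressed COLUMN sums: `cCol (compress R S) κ ds(·,j) e′ ≤ e^{κr₁}·Σ_{e ∈ S}‖R(e,e′)‖`. -/
theorem cCol_compress_le_of_range (R : Matrix ι ι ℂ) (S : Finset ι) (ds : ι → ι → ℝ) (htri : ∀ a b c, ds a c ≤ ds a b + ds b c)
    {κ r₁ w : ℝ} (hκ : 0 ≤ κ) (hrange : ∀ e e', R e e' ≠ 0 → ds e e' ≤ r₁) (j e' : S)
    (hw : ∑ e : S, ‖R e e'‖ ≤ w) :
    cCol (compress R S) κ (fun e : S => ds e j) e' ≤ Real.exp (κ * r₁) * w :=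
  cCol_le_of_range (compress R S) (fun a b : S => ds a b) (fun a b c => htri a b c) hκ
    (fun a b h => hrange a b (by simpa [compress] using h)) j e' (by simpa [compress] using hw)

end Summit.QuantumFields.BalabanUV.Gaps.D4WalkBlockSchurRange

end
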